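/-
Copyright (c) 2026 the pub-hodgecm-mathlib formalisation cell (harness21).  Prover seat hodgecm-mathlib-A-p03 (g26); road «W′ = R1LL-WILD», sub-socket (B6-O) FILE B
(place-level half: labelled eigenvalues of the descended torus + deepness from depth), 2026-09-01.
-/
import Literature.NumberTheory.Rogawski1990.RankOneUnstableWildDepthSignDictionary   -- ★ p844273 (this seat) (B6-O) FILE A: the dictionaries in Eisenstein coordinates
import HarnessLib

/-!
# (W′-B6)∕(B6-O) FILE B, place level — THE LABELLED EIGENVALUES OF A DESCENDED TORUS ELEMENT and DEEPNESS FROM DEPTH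
# (`D·X·D⁻¹ = s • ι(a + b·M_τ)` framed by `X·Q = Q·diag(x₀, x₁)` ⇒ `x₀ = s(ι a + ι b·τ)`, `x₁ = s(ι a + ι b·τ′)` for the frame's eigenline; `|x₀ − x₁|` small ⇒ `a ≠ 0`,
# `|ι(b∕a)·τ| < 1`, … — the hypotheses of ★ FILE A) (Labesse–Langlands 1979 §2 (2.1); Labesse 2024 Prop. 0.0.11)

Topic `NumberTheory/Rogawski1990`; namespace `Literature.NumberTheory.Rogawski1990`.  THEOREMS ONLY (no definition, no instance, no notation, no named fact, no `sorry`).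
Cell `pub/hodgecm-mathlib` (D-0151), crux H413 = `stmt-HodgeConjecture-24833`, road «W′» (architect A-p16 (g28) A-32∕A-37∕A-44∕A-45; (W′-B6) F0P3-p01 (g14); (B6-H) ★ A-p13 p844241
`forall_exists_descent_eq_smul_regRep_of_pos` supplies, for every `t ∈ Z(t₀)`, `diag(1,α)·↑(E₂ t.1)·diag(1,α⁻¹) = s_t • ι(!![a_t, b_t v₀; b_t, a_t + b_t u₀])`; the PAIR∕eigenframe
files supply the `L_w`-frame `↑(E₂ t.1)·Q = Q·diag((τ₀ t)_w, (τ₁ t)_w)`).  HONEST LABEL: HC_CM is proved only modulo the printed citations (hLiu418, h413) until rung 0 closes;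
this file is `2 × 2` linear algebra and ultrametric bookkeeping and asserts nothing printed.

* §1 (fields `F ⊂ E`, `ι`, `τ τ′` with `τ + τ′ = ι u₀`, `τ τ′ = −ι v₀`): `regRep_map_mulVec_eigenvec[']` (the `t`-FREE eigenlines `(−τ′ : 1)`, `(−τ : 1)` of `ι(a + b M_τ)`),
  `eigenvec_dichotomy_of_regRep_map` (an eigenvector of `ι(a + bM_τ)`, `b ≠ 0`, lies on one of them), **`eigen_labels_of_descent_frame`** (`x₀ = s(ι a + ι b τ)` and
  `x₁ = s(ι a + ι b τ′)` when the frame's column `0` descends to `(−τ′ : 1)`) — the labelling is decided ONCE by the fixed frame, hence constant along the torus.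
* §2 (`L_w`, valuations): **`deep_bounds_of_valued_sub_lt`** — for norm-one `x₀, x₁` so labelled, `|x₀ − x₁|` below two explicit thresholds forces `a ≠ 0`, `|ι(b∕a)τ| < 1`,
  `|ι(b∕a)τ′| < 1`, `|ι(b∕a)·ι u₀| < |2|`, `|ι(2(b∕a)u₀)| < |16|` — exactly ★ FILE A's deep-locus hypotheses, read off the fold's depth `N t`.

## References
* [LabesseLanglands1979] J.-P. Labesse, R. P. Langlands, *L-indistinguishability for SL(2)*, Canad. J. Math. 31 (1979): §2 (2.1) p. 8.
* [Labesse2024StabilisationGermesSL2] J.-P. Labesse, arXiv:2411.14820: Prop. 0.0.10–0.0.11 pp. 7–8 (`T̃_{E∕F}(F) = E^× ↪ GL₂(F)` by the regular representation).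
* [Rogawski1990] J. D. Rogawski, *Automorphic Representations of Unitary Groups in Three Variables* (1990): §3.6 pp. 31–32, §4.9 p. 56.
-/

set_option autoImplicit false

noncomputable section

open NumberField IsDedekindDomain Matrix

namespace Literature.NumberTheory.Rogawski1990

open Literature.NumberTheory.Automorphic Literature.NumberTheory.Automorphic.UnitaryGroup Literature.NumberTheory.GaloisRepresentations

/-! ## §1 The labelled eigenvalues of `s • ι(a + b·M_τ)` -/

section Labels

variable {F E : Type*} [Field F] [Field E] (ι : F →+* E) {u₀ v₀ : F} {τ τ' : E}

/-- **THE EIGENLINE `(−τ′ : 1)`**: `ι(a + b M_τ) · (−τ′, 1) = (ι a + ι b τ)·(−τ′, 1)` for `τ + τ′ = ι u₀`, `ττ′ = −ι v₀` (`M_τ = [[0, v₀],[1, u₀]]` the regular representation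
of `τ`). [cite: Labesse2024StabilisationGermesSL2, Prop. 0.0.10] [cite: LabesseLanglands1979, §2 (2.1)] -/
theorem regRep_map_mulVec_eigenvec (hsum : τ + τ' = ι u₀) (hprod : τ * τ' = -ι v₀) (a b : F) :
    ((!![a, b * v₀; b, a + b * u₀]).map ι) *ᵥ ![-τ', 1] = (ι a + ι b * τ) • ![-τ', 1] := by
  have hu : ι u₀ = τ + τ' := hsum.symm
  ext i; fin_cases i
  · simp [Matrix.mulVec, dotProduct, Fin.sum_univ_two, map_mul]
    linear_combination (ι b) * hprod
  · simp [Matrix.mulVec, dotProduct, Fin.sum_univ_two, map_mul, map_add, hu]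
    ring

/-- The other eigenline `(−τ : 1)` with eigenvalue `ι a + ι b τ′`. [cite: Labesse2024StabilisationGermesSL2, Prop. 0.0.10] -/
theorem regRep_map_mulVec_eigenvec' (hsum : τ + τ' = ι u₀) (hprod : τ * τ' = -ι v₀) (a b : F) :
    ((!![a, b * v₀; b, a + b * u₀]).map ι) *ᵥ ![-τ, 1] = (ι a + ι b * τ') • ![-τ, 1] :=
  regRep_map_mulVec_eigenvec ι (τ := τ') (τ' := τ) (by rw [add_comm, hsum]) (by rw [mul_comm, hprod]) a b

/-- **EIGENVECTOR DICHOTOMY**: an eigenvector `(p, q)` of `ι(a + b M_τ)` with `b ≠ 0` has `q ≠ 0` and lies on `(−τ′ : 1)` or on `(−τ : 1)`.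
[cite: Labesse2024StabilisationGermesSL2, Prop. 0.0.10] [cite: LabesseLanglands1979, §2 (2.1)] -/
theorem eigenvec_dichotomy_of_regRep_map (hsum : τ + τ' = ι u₀) (hprod : τ * τ' = -ι v₀) {a b : F} (hb : b ≠ 0) {p q lam : E}
    (hpq : (p, q) ≠ (0, 0)) (heig : ((!![a, b * v₀; b, a + b * u₀]).map ι) *ᵥ ![p, q] = lam • ![p, q]) :
    q ≠ 0 ∧ (p = -τ' * q ∨ p = -τ * q) := by
  have hιb : ι b ≠ 0 := (map_ne_zero ι).2 hb
  have h0 := congr_fun heig 0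
  have h1 := congr_fun heig 1
  simp [Matrix.mulVec, dotProduct, Fin.sum_univ_two, map_mul, map_add] at h0 h1
  -- `h0 : ι a * p + ι b * ι v₀ * q = lam * p`, `h1 : ι b * p + (ι a + ι b * ι u₀) * q = lam * q`
  have hq : q ≠ 0 := by
    rintro rfl
    have hp : p = 0 := by
      have : ι b * p = 0 := by linear_combination h1
      exact (mul_eq_zero.1 this).resolve_left hιb
    exact hpq (by rw [hp])
  refine ⟨hq, ?_⟩
  -- `μ := (lam − ι a)∕ι b` satisfies `p = (μ − ι u₀) q` and `μ² − ι u₀ μ − ι v₀ = 0`, i.e. `(μ − τ)(μ − τ′) = 0`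
  set μ : E := (lam - ι a) / ι b with hμ
  have hlam : lam = ι a + ι b * μ := by rw [hμ, mul_div_cancel₀ _ hιb]; ring
  have hp : p = (μ - ι u₀) * q := by
    have : ι b * p = ι b * ((μ - ι u₀) * q) := by rw [hlam] at h1; linear_combination h1
    exact mul_left_cancel₀ hιb this
  have hquad : (μ - τ) * (μ - τ') * q = 0 := by
    have e0 : ι b * (ι v₀ * q - μ * p) = 0 := by rw [hlam] at h0; linear_combination h0
    have e1 : ι v₀ * q = μ * p := by have := (mul_eq_zero.1 e0).resolve_left hιb; linear_combination this
    rw [hp] at e1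
    have hu : ι u₀ = τ + τ' := hsum.symm
    rw [hu] at e1
    linear_combination -e1 + q * hprod
  rcases mul_eq_zero.1 hquad with h | h
  · rcases mul_eq_zero.1 h with h' | h'
    · left; rw [hp, sub_eq_zero.1 h', ← hsum]; ring
    · right; rw [hp, sub_eq_zero.1 h', ← hsum]; ring
  · exact absurd h hq

/-- **THE LABELLED EIGENVALUES OF A DESCENDED, FRAMED ELEMENT.**  If `X·Q = Q·diag(x₀, x₁)`, `D·X·D′ = s • ι(a + b M_τ)` with `D′·D = 1`, and column `0` of the descended frame
`V := D·Q` lies on the eigenline `(−τ′ : 1)` (`V₀₀ = −τ′·V₁₀`, `V₁₀ ≠ 0`), then **`x₀ = s·(ι a + ι b·τ)`**; if moreover `Q` is invertible, **`x₁ = s·(ι a + ι b·τ′)`** (trace).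
The hypothesis on `V` is decided by the FIXED frame, so along a torus framed by one `Q` the labelling never flips. [cite: LabesseLanglands1979, §2 (2.1)] [cite: Rogawski1990, §3.6 pp. 31–32] -/
theorem eigen_labels_of_descent_frame (hsum : τ + τ' = ι u₀) (hprod : τ * τ' = -ι v₀) {a b : F} {s x₀ x₁ : E}
    {X Q D D' : Matrix (Fin 2) (Fin 2) E} (hX : X * Q = Q * Matrix.diagonal ![x₀, x₁]) (hDD : D' * D = 1)
    (hG : D * X * D' = s • (!![a, b * v₀; b, a + b * u₀]).map ι)
    (hcol : (D * Q) 0 0 = -τ' * (D * Q) 1 0) (h10 : (D * Q) 1 0 ≠ 0) (hQ : IsUnit Q.det) :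
    x₀ = s * (ι a + ι b * τ) ∧ x₁ = s * (ι a + ι b * τ') := by
  -- `(s • ι M) · V = V · diag`, `V := D Q`
  have hV : (s • (!![a, b * v₀; b, a + b * u₀]).map ι) * (D * Q) = (D * Q) * Matrix.diagonal ![x₀, x₁] := by
    rw [← hG, Matrix.mul_assoc, Matrix.mul_assoc, ← Matrix.mul_assoc D' D Q, hDD, Matrix.one_mul, hX, Matrix.mul_assoc]
  -- column `0`
  have hcol0 : (s • (!![a, b * v₀; b, a + b * u₀]).map ι) *ᵥ (fun i => (D * Q) i 0) = x₀ • fun i => (D * Q) i 0 := by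
    ext i
    have h := congr_fun (congr_fun hV i) 0
    rw [Matrix.mul_apply] at h
    simp only [Matrix.mulVec, dotProduct, Pi.smul_apply, smul_eq_mul]
    rw [h, Matrix.mul_apply, Fin.sum_univ_two, Matrix.diagonal_apply_eq, Matrix.diagonal_apply_ne _ (by decide : (1 : Fin 2) ≠ 0)]
    simp
    ring
  have hvec : (fun i => (D * Q) i 0) = (D * Q) 1 0 • ![-τ', 1] := by
    ext i; fin_cases i
    · simp [hcol, mul_comm]
    · simp
  rw [hvec, Matrix.mulVec_smul, Matrix.smul_mulVec, regRep_map_mulVec_eigenvec ι hsum hprod a b, smul_smul, smul_smul] at hcol0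
  have h1 := congr_fun hcol0 1
  simp only [Pi.smul_apply, Matrix.cons_val_one, Matrix.cons_val_fin_one, smul_eq_mul, mul_one] at h1
  -- `h1 : V₁₀ * (s * (ι a + ι b * τ)) = x₀ * V₁₀` (up to the order `simp` chose)
  have hx₀ : x₀ = s * (ι a + ι b * τ) := by
    have h1' : (D * Q) 1 0 * (s * (ι a + ι b * τ)) = (D * Q) 1 0 * x₀ := by linear_combination h1
    exact (mul_left_cancel₀ h10 h1').symm
  refine ⟨hx₀, ?_⟩
  -- trace
  have htr : X.trace = x₀ + x₁ := by
    have hQinv : Q * Q⁻¹ = 1 := Matrix.mul_nonsing_inv Q hQ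
    have : X = Q * Matrix.diagonal ![x₀, x₁] * Q⁻¹ := by rw [← hX, Matrix.mul_assoc, hQinv, Matrix.mul_one]
    rw [this, Matrix.trace_mul_cycle, Matrix.nonsing_inv_mul Q hQ, Matrix.one_mul, Matrix.trace_fin_two, Matrix.diagonal_apply_eq,
      Matrix.diagonal_apply_eq]
    simp
  have htr' : X.trace = s * (2 * ι a + ι b * ι u₀) := by
    have h := congr_arg Matrix.trace hG
    rw [Matrix.trace_mul_cycle, hDD, Matrix.one_mul] at h
    rw [h, Matrix.trace_smul, Matrix.trace_fin_two, smul_eq_mul]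
    simp only [Matrix.map_apply, Matrix.of_apply, Matrix.cons_val', Matrix.cons_val_zero, Matrix.cons_val_one, Matrix.cons_val_fin_one, map_add, map_mul]
    ring
  rw [htr, hx₀, hsum.symm] at htr'
  linear_combination htr'

end Labels

/-! ## §2 Deepness from depth -/

section Deep

variable (L : Type) [Field L] [NumberField L] (v : HeightOneSpectrum (𝓞 ↥(maximalRealSubfield L))) (w : PlacesOver L v)

/-- **DEEPNESS FROM DEPTH**: for norm-one labelled eigenvalues `x₀ = s(ι a + ι b τ)`, `x₁ = s(ι a + ι b τ′)` (`|x₁|_w = 1`) with `|x₀ − x₁|_w·|τ′|_w < |τ − τ′|_w`: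
`a ≠ 0` and `|ι(b∕a)·τ′|_w < 1`; hence `|s·ι a|_w = 1` and **`|ι(b∕a)|_w·|τ − τ′|_w = |x₀ − x₁|_w`** — the window coordinate `b∕a` (B-p04 (g35)'s `G₁₀∕G₀₀`) has valuation read off the
fold's depth `|x₀ − x₁| = |(τ₀ t − τ₁ t)_w|`. [cite: LabesseLanglands1979, §2 (2.2)] [cite: Rogawski1990, §4.9 p. 56] -/
theorem deep_bounds_of_valued_sub_lt {a b : v.adicCompletion ↥(maximalRealSubfield L)} {s x₀ x₁ τ τ' : w.1.adicCompletion L}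
    (hx₀ : x₀ = s * (toPlace v w a + toPlace v w b * τ)) (hx₁ : x₁ = s * (toPlace v w a + toPlace v w b * τ'))
    (h1 : Valued.v x₁ = 1) (hsmall : Valued.v (x₀ - x₁) * Valued.v τ' < Valued.v (τ - τ')) :
    a ≠ 0 ∧ Valued.v (toPlace v w (b / a) * τ') < 1 ∧ Valued.v (s * toPlace v w a) = 1 ∧
      Valued.v (toPlace v w (b / a)) * Valued.v (τ - τ') = Valued.v (x₀ - x₁) := by
  have hdiff : x₀ - x₁ = s * toPlace v w b * (τ - τ') := by rw [hx₀, hx₁]; ring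
  -- KEY: `|ι b τ′| < |ι a|`; otherwise `1 = |x₁| ≤ |s ι b τ′|` and `|x₀ − x₁| |τ′| ≥ |τ − τ′|`
  have hkey : Valued.v (toPlace v w b * τ') < Valued.v (toPlace v w a) := by
    by_contra hle
    rw [not_lt] at hle
    have hx1le : (1 : WithZero (Multiplicative ℤ)) ≤ Valued.v s * Valued.v (toPlace v w b * τ') := by
      rw [← h1, hx₁, Valuation.map_mul]
      exact mul_le_mul_right ((Valuation.map_add _ _ _).trans (max_le hle le_rfl)) _
    have hge : Valued.v (τ - τ') ≤ Valued.v (x₀ - x₁) * Valued.v τ' := by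
      rw [Valuation.map_mul] at hx1le
      rw [hdiff, Valuation.map_mul, Valuation.map_mul]
      calc Valued.v (τ - τ') = 1 * Valued.v (τ - τ') := (one_mul _).symm
        _ ≤ (Valued.v s * (Valued.v (toPlace v w b) * Valued.v τ')) * Valued.v (τ - τ') := mul_le_mul_left hx1le _
        _ = Valued.v s * Valued.v (toPlace v w b) * Valued.v (τ - τ') * Valued.v τ' := by
          simp only [mul_comm, mul_left_comm]
    exact absurd (lt_of_le_of_lt hge hsmall) (lt_irrefl _)
  have ha : a ≠ 0 := by
    rintro rfl
    rw [map_zero, Valuation.map_zero] at hkey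
    exact not_lt_zero hkey
  have hιa : toPlace v w a ≠ 0 := (map_ne_zero _).2 ha
  have hιa0 : Valued.v (toPlace v w a) ≠ 0 := (Valuation.ne_zero_iff _).2 hιa
  have hq : Valued.v (toPlace v w (b / a) * τ') < 1 := by
    rw [map_div₀, div_mul_eq_mul_div, Valuation.map_div, div_lt_one₀ ((Valuation.pos_iff _).2 hιa)]
    exact hkey
  have hunit : Valued.v (toPlace v w a + toPlace v w b * τ') = Valued.v (toPlace v w a) := by
    rw [Valuation.map_add_eq_of_lt_left _ hkey]
  have hsa : Valued.v (s * toPlace v w a) = 1 := by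
    rw [Valuation.map_mul, ← hunit, ← Valuation.map_mul, ← hx₁, h1]
  refine ⟨ha, hq, hsa, ?_⟩
  rw [hdiff, Valuation.map_mul, Valuation.map_mul, map_div₀, Valuation.map_div]
  rw [Valuation.map_mul] at hsa
  have : Valued.v s = (Valued.v (toPlace v w a))⁻¹ := eq_inv_of_mul_eq_one_left hsa
  rw [this]
  field_simp

/-- Ultrametric corollaries for ★ FILE A's hypotheses: from `|β τ′| < 1`, `|τ| = |τ′|`, `τ + τ′ = ι u₀`: `|β τ| < 1` and `|β ι u₀| < 1`. [cite: Omeara1963, §63A] -/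
theorem valued_mul_lt_one_of_conj {β τ τ' u : w.1.adicCompletion L} (h : Valued.v (β * τ') < 1) (hττ : Valued.v τ = Valued.v τ') (hsum : τ + τ' = u) :
    Valued.v (β * τ) < 1 ∧ Valued.v (β * u) < 1 := by
  have hτ : Valued.v (β * τ) < 1 := by rw [Valuation.map_mul, hττ, ← Valuation.map_mul]; exact h
  refine ⟨hτ, ?_⟩
  rw [← hsum, mul_add]
  exact lt_of_le_of_lt (Valuation.map_add _ _ _) (max_lt hτ h)

end Deep

end Literature.NumberTheory.Rogawski1990

end
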